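import Literature.NumberTheory.Automorphic.AlgebraicWeightCohomologyModel
import Literature.NumberTheory.Automorphic.AlgebraicWeightStageLatticesFinite
import Literature.NumberTheory.Automorphic.TameLevelHeckeNilpotent
import Literature.NumberTheory.Automorphic.TwistedQuotientLevelProdSemilinear
import Literature.Algebra.Module.QuotientFreeModuleSemilinear
import HarnessLib

/-!
# Hecke operators small in `𝕋(K^p)` act divisibly by `p^s` on `H^q(Γ, indFun M_S)`

Topic `NumberTheory/Automorphic`; namespace `Literature.NumberTheory.Automorphic.AlgebraicWeight`.
Theorems only; no named fact, no instance, no `sorry`.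

The nilpotence step of the proof of [Scholze2015, Thm. V.4.1], assembled for the algebraic
coefficient system `V_λ(ℚ̄_p)` of `GL_n` over a number field `K`, a tame level `𝒰`, and a stage
lattice `M_S` (`AlgebraicWeight.stageLattice`): for every `s` there is an `r` such that, whenever a
noncommutative polynomial `Q` in generators `tⱼ ∈ GL_n(𝔸_K^∞)` (with `π(tⱼ) = 1`,
`u tⱼ u⁻¹ ∈ U_r tⱼ U_r`, and `U_r tⱼ U_r / U_r → U tⱼ U / U` bijective — the spherical `t_{w,i}` and
the central `t_{w,n}⁻¹`, `w ∉ S`) evaluated at the families `𝒰.heckeOperator tⱼ` vanishes in the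
factors `(r, s, b)`, `b ≤ q`, of `∏ End(H^b(X_{U_r}, ℤ/p^s))`, then
`Q(T_ind)^{q+1} (H^q(Γ, indFun M_S)) ⊆ p^s · H^q(Γ, indFun M_S)`
(`exists_eq_pow_smul_of_heckeOperator_eq_zero`).

Chain: `U_r` acts trivially on `M_S/p^s` (`exists_modTrivialOn_stageLattice`); `M_S` is finite
free over `ℤ_p` (`moduleFree_stageLattice`), so `M_S/p^s ≅ (ℤ/p^s)^κ` semilinearly
(`quotSemimapPadicInt`); the vanishing hypothesis gives `Q([U_r tⱼ U_r])^{q+1} = 0` on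
`H^q(Γ, W^{U/U_r})` with `ℤ/p^s`-coefficients (`pow_succ_map_φZ_heckePolyTower_eq_zero_of_heckeOperator`),
transported to `ℤ_p`-coefficients (`pow_map_φZ_eq_zero_of_semilinear`), and the Bockstein /
reduction step (`exists_eq_nsmul_of_pow_map_φZ_eq_zero`) gives divisibility by `p^s` upstairs.

## References

* P. Scholze, *On torsion in the cohomology of locally symmetric varieties*, Ann. of Math. 182
  (2015), §V.4, proof of Thm. V.4.1. [Scholze2015]
-/

noncomputable section

open CategoryTheory
open IsDedekindDomain NumberField
open Literature.NumberTheory.Automorphic.BigHeckeGLn Literature.NumberTheory.Automorphic.TwistedQuotient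
open Literature.Algebra.Module

namespace Literature.NumberTheory.Automorphic

namespace AlgebraicWeight

variable (K : Type) [Field K] [NumberField K] (n p : ℕ) [Fact p.Prime]
  (lam : (K →+* PadicAlgCl p) → Fin n → ℤ)

/-- Multiplication by `p^s` is injective on a stage lattice. [folklore] -/
theorem pow_smul_injective_stageLattice (S : Finset (PadicAlgCl p)) (s : ℕ) :
    Function.Injective fun m : stageLattice K n p lam S => (((p ^ s : ℕ) : ℤ_[p])) • m :=
  fun _ _ h => Subtype.ext (pow_smul_injective K n p lam s (congrArg Subtype.val h))

/-- `ker (ℤ_p → ℤ/p^s) = (p^s)` with the natural-number cast. [folklore] -/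
theorem ker_toZModPow_eq_span_natCast (s : ℕ) :
    RingHom.ker (PadicInt.toZModPow s : ℤ_[p] →+* ZMod (p ^ s)) =
      Ideal.span {(((p ^ s : ℕ) : ℤ_[p]))} := by
  rw [Nat.cast_pow]
  exact PadicInt.ker_toZModPow s

/-- **Small Hecke operators act divisibly by `p^s` on `H^q(Γ, indFun M_S)`** (the nilpotence step
of the proof of [Scholze2015, Thm. V.4.1] for the stage lattice `M_S`): for every `s` there is an
`r` such that every `Q(T)` vanishing on `H^b(X_{U_r}, ℤ/p^s)`, `b ≤ q`, satisfies
`Q(T_ind)^{q+1} x ∈ p^s H^q(Γ, indFun M_S)` for all `x`.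
[cite: Scholze2015, §V.4 (proof of Thm. V.4.1)] -/
theorem exists_eq_pow_smul_of_heckeOperator_eq_zero (𝒰 : TameLevel n K p)
    {S : Finset (PadicAlgCl p)} (hS : ∀ c ∈ S, ‖c‖ ≤ 1) (s q : ℕ) {I : Type*}
    (t : I → FiniteAdelicGL n K) (ht : ∀ i, ResGLnCohomology.padicCoeffRep n K p lam (t i) = 1)
    (hconjₜ : ∀ (r : ℕ) (i : I) (u : 𝒰.subgroup), ∃ a ∈ 𝒰.tower r, ∃ b ∈ 𝒰.tower r,
      (u : FiniteAdelicGL n K) * t i * (u : FiniteAdelicGL n K)⁻¹ = a * t i * b)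
    (hbijₜ : ∀ (r : ℕ) (i : I), Set.BijOn (Subgroup.quotientMapOfLE (𝒰.tower_le r))
      (ArithmeticQuotient.doubleCosetQuot (𝒰.tower r) (t i))
      (ArithmeticQuotient.doubleCosetQuot 𝒰.subgroup (t i))) :
    ∃ r : ℕ, ∀ Q : FreeRing I,
      (∀ b ≤ q, FreeRing.lift (fun j => 𝒰.heckeOperator (t j)) Q (r, s, b) = 0) →
      ∀ x : groupCohomology (indFun (globalEmbedding n K) 𝒰.subgroup
          (latticeRep 𝒰.subgroup (padicIntRep K n p lam) (stageLattice K n p lam S)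
            (stageLattice_stable K n p lam 𝒰 S))) q,
        ∃ y, (heckePolyIndEnd K n p lam 𝒰.subgroup (stageLattice K n p lam S)
            (stageLattice_stable K n p lam 𝒰 S) t ht q Q ^ (q + 1)) x =
          (((p ^ s : ℕ) : ℤ_[p])) • y := by
  obtain ⟨r, hL'⟩ := exists_modTrivialOn_stageLattice K n p lam 𝒰 S s
  refine ⟨r, fun Q hQ x => ?_⟩
  haveI := moduleFinite_stageLattice K n p lam hS
  haveI := moduleFree_stageLattice K n p lam hS
  haveI : RingHomSurjective (PadicInt.toZModPow s : ℤ_[p] →+* ZMod (p ^ s)) :=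
    ⟨toZModPow_surjective p s⟩
  -- the data
  have hbij := quotSemimap_bijective (PadicInt.toZModPow s)
    (Module.Free.chooseBasis ℤ_[p] (stageLattice K n p lam S)) _
    (ker_toZModPow_eq_span_natCast p s) (toZModPow_surjective p s)
  have hσq := modRep_eq_one_of_modTrivialOn (padicIntRep K n p lam) (stageLattice K n p lam S)
    (stageLattice_stable K n p lam 𝒰 S) (p ^ s) hL'
  -- (C): nilpotence with `ℤ/p^s`-coefficients, for the transported representation
  have hC := TameLevel.pow_succ_map_φZ_heckePolyTower_eq_zero_of_heckeOperator 𝒰 r t (hconjₜ r)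
    (transportRep (quotSemimap (PadicInt.toZModPow s)
      (Module.Free.chooseBasis ℤ_[p] (stageLattice K n p lam S)) _
      (ker_toZModPow_eq_span_natCast p s)) hbij
      (quotRep (modRep 𝒰.subgroup (latticeRep 𝒰.subgroup (padicIntRep K n p lam)
        (stageLattice K n p lam S) (stageLattice_stable K n p lam 𝒰 S)) (p ^ s)) hσq))
    Q q hQ
  -- (Z): transport to `ℤ_p`-coefficients
  have hZ := pow_map_φZ_eq_zero_of_semilinear (globalEmbedding n K) (𝒰.tower_le r)
    (quotRep (modRep 𝒰.subgroup (latticeRep 𝒰.subgroup (padicIntRep K n p lam)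
      (stageLattice K n p lam S) (stageLattice_stable K n p lam 𝒰 S)) (p ^ s)) hσq)
    (transportRep (quotSemimap (PadicInt.toZModPow s)
      (Module.Free.chooseBasis ℤ_[p] (stageLattice K n p lam S)) _
      (ker_toZModPow_eq_span_natCast p s)) hbij
      (quotRep (modRep 𝒰.subgroup (latticeRep 𝒰.subgroup (padicIntRep K n p lam)
        (stageLattice K n p lam S) (stageLattice_stable K n p lam 𝒰 S)) (p ^ s)) hσq))
    (quotSemimap (PadicInt.toZModPow s)
      (Module.Free.chooseBasis ℤ_[p] (stageLattice K n p lam S)) _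
      (ker_toZModPow_eq_span_natCast p s))
    (transportRep_apply_apply _ hbij _) t (hconjₜ r)
    (fun i => TameLevel.finite_doubleCosetQuot_tower r (t i)) hbij Q q (q + 1) hC
  -- (H2): Bockstein / reduction
  obtain ⟨y, hy⟩ := exists_eq_nsmul_of_pow_map_φZ_eq_zero (globalEmbedding n K) (𝒰.tower_le r)
    (padicIntRep K n p lam) (stageLattice K n p lam S) (stageLattice_stable K n p lam 𝒰 S) (p ^ s)
    t (padicIntRep_eq_one K n p lam t ht) (hconjₜ r)
    (fun i => finite_orbit_quotient 𝒰.subgroup (t i))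
    (fun i => TameLevel.finite_doubleCosetQuot_tower r (t i)) (hbijₜ r) hL'
    (pow_smul_injective_stageLattice K n p lam S s) Q q hZ x
  refine ⟨y, ?_⟩
  rw [← functor_map_heckePolyInd_pow_apply, hy, Nat.cast_smul_eq_nsmul]

end AlgebraicWeight

end Literature.NumberTheory.Automorphic
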